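import Mathlib.Data.Finite.Sigma
import Mathlib.Data.Finite.Prod
import Literature.AnabelianGeometry.SemiGraphs.SubgroupPresentationArithActCloseRigidity
import Literature.AnabelianGeometry.SemiGraphs.ArithTemperedGroupOfOuterAction
import HarnessLib

/-!
# [SemiAnbd] Prop 5.2 (i) / Def 5.1 (i)(c): congruence-continuity of an outer action modulo a CONNECTED COSET LEVEL
# (a tree level) from congruence modulo a deep FINITE level — the assembled automatic-continuity argument at the outer
# semidirect product (piece (P3-core) of the «T54-HCCT-PRODUCER» programme; proof-only)

Mochizuki, *Semi-graphs of anabelioids*, Publ. RIMS **42** (2006) 221–322, §5: Def 5.1 (i) p. 62, Prop 5.2 (i) p. 63 and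
its proof p. 64 l. 67–74 («Assertions (i), (ii) follow from the various finiteness assumptions in our definition of a
"continuous action"»), §0 p. 5 (outer semi-direct products), proof of Thm 5.4 p. 66.
[cite: MochizukiSemiAnbd2006, Prop 5.2 (i), p. 63]

PROOF-ONLY file (abc-iut cell, layer L3, row «T54-HCCT-PRODUCER» of abc-iut-L3-lead δ7 (7) / δ23; seat abc-iut-w4-d085
gen 10; piece (P3-core) of `HOME/staging/w4/w4-d085/g10/SHAPES-T54-HCCT.md`).  No definition, no instance, no new named
fact.  Assembles this seat's p512058 (§1 pigeonhole, §3 glue), p513416/p514384 (rigidity at a coset level, arithAct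
instance) with abc-iut-L3-d4's `SubgroupPresentationArithAction` at the OUTER SEMIDIRECT PRODUCT `G ⋊^out Π_A`
(`NotationsConventions.outerSemidirectProduct`, `conj_toOuterSemidirectProduct` of `ArithTemperedGroupOfOuterAction`).

WHAT IS PROVED (`exists_nhds_forall_rep_congr_of_connected_cosetLevel`).  Data: a topological group `G`, an outer
action `ρ : Π_A →* Out_top(G)` of a STRONGLY COMPLETE `Π_A` (`hsc`), a base action `baseAct : Π_A →* Aut 𝔾` on a FINITE
semi-graph, a subgroup presentation `P` of `𝔾` in `G` which is `IsArithCompatible` for the arithmetic group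
`E := G ⋊^out Π_A` (acting on `G` through the automorphism component and on `𝔾` through `baseAct`) — the T54 capstones'
`isArithCompatible_piPresentation_outerAction_of_branchPair_chart_of_finite` —, and a NORMAL `E`-stable level `K`
with FINITE images of the `H_w`, `M_ε` in `G ⧸ K` and CONNECTED coset semi-graph `P.cosetGraph K` (a tree level
`ker projAut n`).  Then there is a FINITE `E₀ ⊆ G ∖ K` such that: for every NORMAL, `E`-stable, FINITE-INDEX level
`L ⊇ K` avoiding `E₀` and every finite-index `S₁ ≤ Π_A` on which the base action is trivial and every `ρ a` has a
representative congruent to the identity MODULO `L` (abc-iut-w4-d029's p457557 at a finite characteristic level),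
every `a` in some neighbourhood of `1` has a representative congruent to the identity MODULO `K` — the capstone's
TEMPERED congruence-continuity `hCCt` at the level `K`.

Proof = print's «finiteness»: the invariant `a ↦ arithAct_L(φ_a, a) ∈ Aut (P.cosetGraph L)` is FINITE-valued
(`G ⧸ L` finite); equal invariants for `a, b ∈ S₁` make `e := (φ_b, b)⁻¹ (φ_a, a)` act trivially on the level-`L` coset
semi-graph, whence vertex / edge conjugators IN `L` and `Φ_e ≡ id (mod L)`; by p514384 `Φ_e = φ_b⁻¹ φ_a` is inner
modulo `K`; by p512058 §3 the class `ρ(b⁻¹ a)` has a representative `≡ id (mod K)`; p512058 §1 concludes.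
HONEST RESIDUAL (for the capstone instantiation (P3-top), not here): the separation «some deep finite characteristic
level `L_m · K` avoids `E₀`» (the finite levels separate `Gal(𝒢_{∞,n}/𝒢)`), finiteness of `H_w K/K` (compact/open),
connectedness of the tree level, and an open subgroup of `Π_A` inside p457557's neighbourhood.  No side taken on
[IUTchIII] Cor. 3.12; typed ≠ proved.
-/

namespace Literature.AnabelianGeometry.SemiGraphs

namespace SemiGraph

namespace SubgroupPresentation

open CategoryTheory Topology Filter Literature.AnabelianGeometry.EtaleTheta
open scoped Pointwise

universe u w

variable {𝔾 : SemiGraph.{u}} {Γ : Type u} [Group Γ] {E : Type w} [Group E] (P : SubgroupPresentation 𝔾 Γ)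
variable {Φ : E →* MulAut Γ} {σ : E →* Aut 𝔾}

/-! ### Conjugators: the full coset -/

/-- Right-multiplying a vertex conjugator by an element of `H_{σ_e w}` gives a vertex conjugator.
[cite: MochizukiSemiAnbd2006, §5 p.65] -/
theorem IsVConj.mul_mem_vertex {e : E} {w : 𝔾.Vertex} {k h : Γ} (hk : P.IsVConj Φ σ e w k)
    (hh : h ∈ P.H ((σ e).hom.vertexMap w)) : P.IsVConj Φ σ e w (k * h) := by
  intro x
  rw [hk x]
  have e1 : (k * h)⁻¹ * Φ e x * (k * h) = h⁻¹ * (k⁻¹ * Φ e x * k) * h := by group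
  rw [e1]
  constructor
  · intro H1
    exact mul_mem (mul_mem (inv_mem hh) H1) hh
  · intro H1
    have := mul_mem (mul_mem hh H1) (inv_mem hh)
    have e2 : h * (h⁻¹ * (k⁻¹ * Φ e x * k) * h) * h⁻¹ = k⁻¹ * Φ e x * k := by group
    rwa [e2] at this

/-- Right-multiplying an edge conjugator by an element of `M_{σ_e ε}` gives an edge conjugator.
[cite: MochizukiSemiAnbd2006, §5 p.65] -/
theorem IsEConj.mul_mem_edge {e : E} {ε : 𝔾.Edge} {m μ : Γ} (hm : P.IsEConj Φ σ e ε m)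
    (hμ : μ ∈ P.M ((σ e).hom.edgeMap ε)) : P.IsEConj Φ σ e ε (m * μ) := by
  refine ⟨fun x hx => ?_, fun b v hb hv => ?_⟩
  · have e1 : (m * μ)⁻¹ * Φ e x * (m * μ) = μ⁻¹ * (m⁻¹ * Φ e x * m) * μ := by group
    rw [e1]
    exact mul_mem (mul_mem (inv_mem hμ) (hm.1 x hx)) hμ
  · obtain ⟨k, hk, hmem⟩ := hm.2 b v hb hv
    refine ⟨k, hk, ?_⟩
    have hμ' : μ⁻¹ ∈ P.M (𝔾.edgeOf ((σ e).hom.branchMap b)) := by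
      rw [(σ e).hom.edgeOf_branchMap, hb]; exact inv_mem hμ
    have h1 := P.conj_mem ((σ e).hom.branchMap b) ((σ e).hom.vertexMap v) ((σ e).hom.abuts_branchMap b v hv) _ hμ'
    have e1 : P.s ((σ e).hom.branchMap b) * (m * μ)⁻¹ * (Φ e (P.s b))⁻¹ * k =
        (P.s ((σ e).hom.branchMap b) * μ⁻¹ * (P.s ((σ e).hom.branchMap b))⁻¹) *
          (P.s ((σ e).hom.branchMap b) * m⁻¹ * (Φ e (P.s b))⁻¹ * k) := by group
    rw [e1]
    exact mul_mem h1 hmem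

end SubgroupPresentation

end SemiGraph

/-! ### The assembled argument at the outer semidirect product -/

section OuterAction

open CategoryTheory Topology Filter Literature.AnabelianGeometry.EtaleTheta SemiGraph SemiGraph.SubgroupPresentation
open scoped Pointwise

universe u v

variable {𝔾 : SemiGraph.{u}} {G : Type u} [Group G] [TopologicalSpace G] [IsTopologicalGroup G]
variable {PA : Type v} [Group PA] [TopologicalSpace PA]

/-- **Congruence-continuity modulo a connected coset level from congruence modulo a deep finite level** ([SemiAnbd]
Prop 5.2 (i) proof, «the various finiteness assumptions», assembled at `G ⋊^out Π_A`).  See the module docstring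
for the data; conclusion: every `a` in some neighbourhood of `1` in `Π_A` has a representative `φ` of `ρ a` with
`φ(y)·y⁻¹ ∈ K` for all `y`. [cite: MochizukiSemiAnbd2006, Prop 5.2 (i), p. 63] -/
theorem exists_nhds_forall_rep_congr_of_connected_cosetLevel (ρ : PA →* TopOut G)
    (hsc : ∀ H : Subgroup PA, H.FiniteIndex → IsOpen (H : Set PA))
    (baseAct : PA →* Aut 𝔾) [Finite 𝔾.Vertex] [Finite 𝔾.Edge] [Finite 𝔾.Branch]
    (P : SubgroupPresentation 𝔾 G)
    (hP : P.IsArithCompatible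
      (((contMulAut G).subtype.comp (MonoidHom.fst _ _)).comp (outerSemidirectProduct ρ).subtype)
      (baseAct.comp (outerSemidirectProductSnd ρ)))
    (K : Subgroup G) [K.Normal]
    (hK : ∀ (e : outerSemidirectProduct ρ) (x : G), x ∈ K → ((e.1.1 : MulAut G)) x ∈ K)
    (hH : ∀ w : 𝔾.Vertex, ((QuotientGroup.mk (s := K)) '' (P.H w : Set G)).Finite)
    (hM : ∀ ε : 𝔾.Edge, ((QuotientGroup.mk (s := K)) '' (P.M ε : Set G)).Finite)
    (hconn : (P.cosetGraph K).IsConnected) :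
    ∃ E₀ : Set G, E₀.Finite ∧ (∀ g ∈ E₀, g ∉ K) ∧
      ∀ (L : Subgroup G), L.Normal → K ≤ L → (∀ g ∈ E₀, g ∉ L) → L.FiniteIndex →
        (∀ (e : outerSemidirectProduct ρ) (x : G), x ∈ L → ((e.1.1 : MulAut G)) x ∈ L) →
        ∀ (S₁ : Subgroup PA), S₁.FiniteIndex →
          (∀ a ∈ S₁, baseAct a = 1 ∧ ∃ φ : contMulAut G, TopOut.mk G φ = ρ a ∧ ∀ y : G, (φ : MulAut G) y * y⁻¹ ∈ L) →
            ∃ U ∈ 𝓝 (1 : PA), ∀ a ∈ U, ∃ φ : contMulAut G, TopOut.mk G φ = ρ a ∧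
              ∀ y : G, (φ : MulAut G) y * y⁻¹ ∈ K := by
  classical
  -- notation for the arithmetic group and its two actions
  set ΦE : outerSemidirectProduct ρ →* MulAut G :=
    ((contMulAut G).subtype.comp (MonoidHom.fst _ _)).comp (outerSemidirectProduct ρ).subtype with hΦE
  set σE : outerSemidirectProduct ρ →* Aut 𝔾 := baseAct.comp (outerSemidirectProductSnd ρ) with hσE
  have hΦE_apply : ∀ (e : outerSemidirectProduct ρ) (x : G), ΦE e x = (e.1.1 : MulAut G) x := fun _ _ => rfl
  have hσE_apply : ∀ e : outerSemidirectProduct ρ, σE e = baseAct e.1.2 := fun _ => rfl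
  have hK' : ∀ (e : outerSemidirectProduct ρ) (x : G), x ∈ K → ΦE e x ∈ K := fun e x hx => hK e x hx
  -- (P2b) at the inner action `ι : G → G ⋊^out Π_A`
  obtain ⟨E₀, hfin, hK₀, hP2b⟩ := P.exists_finite_forall_arithAct_close_congr K hP hK' hH hM hconn
    (toOuterSemidirectProduct ρ) (fun g => rfl)
    (fun g => by rw [hσE_apply, toOuterSemidirectProduct_snd, map_one])
    (fun e g => conj_toOuterSemidirectProduct ρ e g)
  refine ⟨E₀, hfin, hK₀, fun L hL hKL hLE hLfi hLst S₁ hS₁fi hS₁ => ?_⟩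
  haveI : L.Normal := hL
  haveI : L.FiniteIndex := hLfi
  haveI : S₁.FiniteIndex := hS₁fi
  have hL' : ∀ (e : outerSemidirectProduct ρ) (x : G), x ∈ L → ΦE e x ∈ L := fun e x hx => hLst e x hx
  -- the chosen representatives and arithmetic elements over `a ∈ S₁` (junk `1` outside `S₁`)
  let eOf : PA → outerSemidirectProduct ρ := fun a =>
    if h : a ∈ S₁ then ⟨((hS₁ a h).2.choose, a), (hS₁ a h).2.choose_spec.1⟩ else 1
  have eOf_spec : ∀ a (h : a ∈ S₁), (eOf a).1.2 = a ∧ ∀ y : G, ((eOf a).1.1 : MulAut G) y * y⁻¹ ∈ L := by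
    intro a h
    have : eOf a = ⟨((hS₁ a h).2.choose, a), (hS₁ a h).2.choose_spec.1⟩ := dif_pos h
    rw [this]
    exact ⟨rfl, (hS₁ a h).2.choose_spec.2⟩
  -- the FINITE invariant: the arithmetic action on the level-`L` coset semi-graph
  haveI : Finite (G ⧸ L) := Subgroup.finite_quotient_of_finiteIndex
  have hfinDC : ∀ H : Subgroup G, Finite (DoubleCoset.Quotient (H : Set G) (L : Set G)) := by
    intro H
    refine Finite.of_surjective (fun q : G ⧸ L => DoubleCoset.mk H L q.out) fun x => ?_
    induction x using Quotient.inductionOn' with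
    | h g =>
      refine ⟨QuotientGroup.mk g, ?_⟩
      change DoubleCoset.mk H L (QuotientGroup.mk (s := L) g).out = DoubleCoset.mk H L g
      rw [DoubleCoset.eq]
      refine ⟨1, one_mem _, ((QuotientGroup.mk (s := L) g).out)⁻¹ * g, ?_, by group⟩
      rw [← QuotientGroup.eq, QuotientGroup.out_eq']
  haveI : Finite (P.cosetGraph L).Vertex := by
    haveI := fun w => hfinDC (P.H w)
    exact inferInstanceAs (Finite (Σ w : 𝔾.Vertex, P.VClass L w))
  haveI : Finite (P.cosetGraph L).Edge := by
    haveI := fun ε => hfinDC (P.M ε)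
    exact inferInstanceAs (Finite (Σ ε : 𝔾.Edge, P.EClass L ε))
  haveI : Finite (P.cosetGraph L).Branch :=
    inferInstanceAs (Finite {p : 𝔾.Branch × (Σ ε : 𝔾.Edge, P.EClass L ε) // p.2.1 = 𝔾.edgeOf p.1})
  haveI : Finite (Aut (P.cosetGraph L)) :=
    Finite.of_injective (fun α : Aut (P.cosetGraph L) => (α.hom.vertexMap, α.hom.edgeMap, α.hom.branchMap))
      fun α β h => by
        simp only [Prod.mk.injEq] at h
        exact Iso.ext (SemiGraph.hom_ext _ _ h.1 h.2.1 h.2.2)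
  let f : PA → Aut (P.cosetGraph L) := fun a => P.arithAct hP L hL' (eOf a)
  -- pigeonhole (p512058 §1)
  refine exists_nhds_forall_rep_congr_of_finite_invariant ρ hsc K S₁ f fun a ha b hb hab => ?_
  -- the element `e := e_b⁻¹ e_a` acts trivially on the level-`L` coset semi-graph
  set e : outerSemidirectProduct ρ := (eOf b)⁻¹ * eOf a with he
  have harith : P.arithAct hP L hL' e = 1 := by
    rw [he, map_mul, map_inv]
    change (f b)⁻¹ * f a = 1
    rw [hab, inv_mul_cancel]
  obtain ⟨hb2, hbL⟩ := eOf_spec b hb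
  obtain ⟨ha2, haL⟩ := eOf_spec a ha
  -- `σ e = 1`
  have hσ : σE e = 1 := by
    rw [hσE_apply, he]
    have : ((eOf b)⁻¹ * eOf a).1.2 = (eOf b).1.2⁻¹ * (eOf a).1.2 := rfl
    rw [this, map_mul, map_inv, hb2, ha2, (hS₁ a ha).1, (hS₁ b hb).1, inv_one, one_mul]
  -- `Φ_e ≡ id (mod L)`
  have hΦL : ∀ g : G, ΦE e g * g⁻¹ ∈ L := by
    intro g
    rw [hΦE_apply]
    have hcomp : ((e.1.1 : MulAut G)) g = ((eOf b).1.1 : MulAut G)⁻¹ (((eOf a).1.1 : MulAut G) g) := by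
      rw [he]; rfl
    rw [hcomp]
    -- `φ_a g = l g` with `l ∈ L`
    set l : G := ((eOf a).1.1 : MulAut G) g * g⁻¹ with hl
    have hlL : l ∈ L := haL g
    have hg : ((eOf a).1.1 : MulAut G) g = l * g := by rw [hl]; group
    rw [hg, map_mul]
    -- `φ_b⁻¹ l ∈ L` (stability) and `φ_b⁻¹ g · g⁻¹ ∈ L`
    have h1 : ((eOf b).1.1 : MulAut G)⁻¹ l ∈ L := by
      have := hL' (eOf b)⁻¹ l hlL
      rwa [hΦE_apply] at this
    have h2 : ((eOf b).1.1 : MulAut G)⁻¹ g * g⁻¹ ∈ L := by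
      set z : G := ((eOf b).1.1 : MulAut G)⁻¹ g with hz
      have hz' : ((eOf b).1.1 : MulAut G) z = g := by rw [hz, MulAut.inv_apply, MulEquiv.apply_symm_apply]
      have := hbL z
      rw [hz'] at this
      have e1 : z * g⁻¹ = (g * z⁻¹)⁻¹ := by group
      rw [e1]
      exact inv_mem this
    have e2 : ((eOf b).1.1 : MulAut G)⁻¹ l * ((eOf b).1.1 : MulAut G)⁻¹ g * g⁻¹ =
        ((eOf b).1.1 : MulAut G)⁻¹ l * (((eOf b).1.1 : MulAut G)⁻¹ g * g⁻¹) := by group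
    rw [e2]
    exact mul_mem h1 h2
  -- vertex conjugators in `L`: read off the fixed vertex `H_w · 1 · L`
  have hσV : ∀ w : 𝔾.Vertex, (σE e).hom.vertexMap w = w := fun w => by rw [hσ]; rfl
  have hσEd : ∀ ε : 𝔾.Edge, (σE e).hom.edgeMap ε = ε := fun ε => by rw [hσ]; rfl
  have hV : ∀ w : 𝔾.Vertex, ∃ k ∈ L, P.IsVConj ΦE σE e w k := by
    intro w
    have hk := P.isVConj_vConj hP e w
    set k := P.vConj hP e w
    have h1 : (P.arithAct hP L hL' e).hom.vertexMap (P.vMk L w 1) = P.vMk L w 1 := by rw [harith]; rfl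
    rw [P.arithAct_vertexMap_vMk hP L hL' hk, map_one, mul_one] at h1
    have h2 : P.vMk L w 1 = P.vMk L ((σE e).hom.vertexMap w) 1 := P.vMk_eq L (hσV w).symm rfl
    obtain ⟨h, hh, l, hl, h1l⟩ := (DoubleCoset.eq _ _ _ _).mp ((P.vMk_eq_vMk_iff L).mp (h1.trans h2))
    -- `1 = h k⁻¹ l`, so `k h⁻¹ = l … ∈ L`; and `k h⁻¹` is a conjugator
    refine ⟨k * h⁻¹, ?_, hk.mul_mem_vertex P (inv_mem hh)⟩
    have e1 : k * h⁻¹ = l * (h * k⁻¹ * l)⁻¹ := by group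
    rw [e1, ← h1l]
    simpa using hl
  have hEc : ∀ ε : 𝔾.Edge, ∃ m ∈ L, P.IsEConj ΦE σE e ε m := by
    intro ε
    have hm := P.isEConj_eConj hP e ε
    set m := P.eConj hP e ε
    have h1 : (P.arithAct hP L hL' e).hom.edgeMap (P.eMk L ε 1) = P.eMk L ε 1 := by rw [harith]; rfl
    rw [P.arithAct_edgeMap_eMk hP L hL' hm, map_one, mul_one] at h1
    have h2 : P.eMk L ε 1 = P.eMk L ((σE e).hom.edgeMap ε) 1 := P.eMk_eq L (hσEd ε).symm rfl
    obtain ⟨μ, hμ, l, hl, h1l⟩ := (DoubleCoset.eq _ _ _ _).mp ((P.eMk_eq_eMk_iff L).mp (h1.trans h2))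
    refine ⟨m * μ⁻¹, ?_, hm.mul_mem_edge P (inv_mem hμ)⟩
    have e1 : m * μ⁻¹ = l * (μ * m⁻¹ * l)⁻¹ := by group
    rw [e1, ← h1l]
    simpa using hl
  -- (P2b): `Φ_e` is inner modulo `K`
  obtain ⟨l₀, hl₀, hcong⟩ := hP2b L hL hKL hLE e hσ hΦL hV hEc
  -- glue (p512058 §3): a representative of the class of `Φ_e` congruent to the identity modulo `K`
  obtain ⟨Ψ', hΨ', hΨ'K⟩ := exists_rep_congr_of_forall_apply_eq_conj_mul K e.1.1 l₀ fun y => by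
    obtain ⟨k, hk, hyk⟩ := hcong y
    exact ⟨k, hk, by rw [← hΦE_apply]; exact hyk⟩
  refine ⟨Ψ', ?_, hΨ'K⟩
  -- the class of `Φ_e = φ_b⁻¹ φ_a` is `ρ(b⁻¹ a)`
  rw [hΨ', e.2]
  change ρ (((eOf b)⁻¹ * eOf a).1.2) = ρ (b⁻¹ * a)
  have : ((eOf b)⁻¹ * eOf a).1.2 = (eOf b).1.2⁻¹ * (eOf a).1.2 := rfl
  rw [this, hb2, ha2]

end OuterAction

end Literature.AnabelianGeometry.SemiGraphs
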